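import Literature.RepresentationTheory.MoeglinVignerasWaldspurger1987.RankOneThetaLiftIrreducibleProofs
import Literature.RepresentationTheory.TwistedCoinvariantsIsoIntertwiner
import Literature.RepresentationTheory.HeisenbergGroup.DoubledIntertwinerFunctional
import HarnessLib

/-!
# An isomorphism of two rank-one theta lifts gives a non-zero quasi-invariant functional on the doubled oscillator
# (piece P1 of the support-form proof of `rankOne_theta_lines_disjoint`, at the tree's objects)

Topic `RepresentationTheory/MoeglinVignerasWaldspurger1987`; KERNEL ONLY: one theorem, no definition, no named fact, no `sorry`.
Cell hodgecm-mathlib, row IV-4(c1) (B-plan1 KEY «support form», 2026-08-28), owner A-p15.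

AT THE TREE'S OBJECTS of `rankOne_theta_lines_disjoint` (`RankOneThetaLiftLinesDisjoint.lean`): a NON-SPLIT place `v` (`E_v` a field),
a trace-zero `δ ≠ 0` (only to know `c ≠ 1`), two homomorphisms `s₁, s₂ : U(J)(F_v) → S̃p_{ψ_v}(𝕎_v)` (ANY — no section condition is used here), the oscillator actions
`ω_{sᵢ} = (MpPsi.toRep ρ_v) ∘ sᵢ` on `𝒮(F_vᴺ)` (`ω_{s₂}` smooth), the centre `U(J₁)(F_v) = E_v¹ → U(J)(F_v)`, characters `χ₁, χ₂`
of the centre (`χ₂` continuous), and an isomorphism of the coinvariant representations `Θ_{s₁}(χ₁) ≅ Θ_{s₂}(χ₂)` with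
`Θ_{s₁}(χ₁) ≠ 0`.  CONCLUSION (`exists_doubledFunctional_of_areIsomorphicRep`): on the doubled model `𝒮(F_v^{N ⊕ N})` (along any
`e : Fin N ⊕ Fin N ≃ ι`) there is a linear functional `Λ ≠ 0` with
`Λ ∘ (ω_{s₁}(g) ⊠ conj ω_{s₂}(g) conj) = r_g • Λ`, `r_g ≠ 0`, for every `g ∈ U(J)(F_v)`.

Assembly of: `TwistedCoinv.exists_intertwiner_ne_zero_of_coinv_equiv` (the isomorphism lifts to an intertwiner `T ≠ 0`,
`𝒮(F_vᴺ) → 𝒮(F_vᴺ)`, into the `χ₂`-isotypic subspace — compact centre `compactSpace_localPi_one_of_smul_eq`, smooth, open kernel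
`isOpen_ker_of_smul_eq`), `HeisenbergGroup.diagIntegral_sumEndSB_ne_zero` / `…_quasiInvariant` (`Λ := ∫_Δ ∘ (T ⊠ 1)`), and the
CONFORMALITY of every `ω_s(g)` (`exists_l2NormSq_toRep_comp_eq_mul`, [MVW II.1 (A)]: implementers are unique up to a scalar and
an isometric one exists) turned into the scaling of the `L²` pairing by polarization
(`SchwartzBruhat.integral_conj_mul_map_map_of_l2NormSq_eq_mul`).  This `Λ` is the object that pieces P2–P6 (root unipotents,
anisotropy of the doubled plane, change of polarisation, support on a compact quadric shell, p-adic uncertainty) annihilate.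

## References
* [MoeglinVignerasWaldspurger1987] C. Mœglin, M.-F. Vignéras, J.-L. Waldspurger, LNM 1291 (1987), Chap. 2 II.1 (A), II.6; Chap. 3 IV.
* [Liu2021] Y. Liu, Camb. J. Math. 9 (2021), App. D Lemma D.1 (3) (l. 5233) — the consumer (`rankOne_theta_lines_disjoint`).
* [HarrisKudlaSweet1996] M. Harris, S. Kudla, W. J. Sweet, J. AMS 9 (1996) §3 (the doubling see-saw this functional encodes).
-/

set_option autoImplicit false

noncomputable section

open NumberField IsDedekindDomain _root_.MeasureTheory
open scoped Matrix ComplexConjugate ENNReal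
open Literature.RepresentationTheory Literature.RepresentationTheory.HeisenbergGroup
open Literature.NumberTheory.GelbartRogawski1991.UnitaryDualPair.LocalSplitting
open Literature.NumberTheory.Automorphic Literature.NumberTheory.Automorphic.UnitaryGroup
open Literature.NumberTheory.Automorphic.Liu2021

namespace Literature.RepresentationTheory.MoeglinVignerasWaldspurger1987

set_option maxHeartbeats 1600000 in -- large binder statement over the tree's local Weil objects
/-- **P1 of the support-form proof of [Liu2021, Lem. D.1 (3)] (`rankOne_theta_lines_disjoint`): the quasi-invariant doubled
functional.**  At a non-split `v`, for any homomorphisms `s₁, s₂ : U(J)(F_v) → S̃p_{ψ_v}(𝕎_v)` with `ω_{s₂}` smooth, a continuous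
character `χ₂` and any `χ₁` of the centre `E_v¹`, IF the `χ₁`-coinvariants of `ω_{s₁}` are non-zero and the coinvariant
representations `Θ_{s₁}(χ₁)`, `Θ_{s₂}(χ₂)` of `U(J)(F_v)` are isomorphic, THEN on the doubled Schwartz–Bruhat model
`𝒮(F_v^{N ⊕ N})` there is a linear functional `Λ ≠ 0` such that for every `g ∈ U(J)(F_v)`,
`Λ ∘ (ω_{s₁}(g) ⊠ conjOp (ω_{s₂}(g))) = r_g • Λ` with `r_g ≠ 0` (`r_g` = the conformality ratio of `ω_{s₂}(g)`).
[cite: MoeglinVignerasWaldspurger1987, Chap. 2 II.1 (A), II.6] [cite: Liu2021, App. D Lemma D.1 (3) (l. 5233)] -/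
theorem exists_doubledFunctional_of_areIsomorphicRep (F : Type) [Field F] [NumberField F] (E : Type) [Field E]
    [NumberField E] [Algebra F E] [Algebra.IsQuadraticExtension F E] (c : E ≃ₐ[F] E)
    {δ : E} (hcδ : c δ = -δ) (hδ : δ ≠ 0) (N : ℕ)
    (T : Matrix (Fin N) (Fin N) F) (hTd : IsUnit T.det) (J : Matrix (Fin N) (Fin N) E) (v : HeightOneSpectrum (𝓞 F))
    (hE : IsField (UnitaryGroup.LocalRing E v))
    (s₁ s₂ : UnitaryGroup.localPi E c N J v →* LocalMp F N T v)
    (hsm₂ : Representation.IsSmooth ((MpPsi.toRep (localSchrodinger F N T v)).comp s₂))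
    (J₁ : Matrix (Fin 1) (Fin 1) E) (hJ₁ : J₁ 0 0 ≠ 0) (χ₁ χ₂ : UnitaryGroup.localPi E c 1 J₁ v →* ℂˣ)
    (hχ₂c : Continuous fun z => ((χ₂ z : ℂˣ) : ℂ))
    (hnt : Nontrivial (TwistedCoinv.Coinv
      ((show Representation ℂ (UnitaryGroup.localPi E c 1 J₁ v) (SchwartzBruhat (Fin N → v.adicCompletion F)) from
        ((MpPsi.toRep (localSchrodinger F N T v)).comp s₁).comp (UnitaryGroup.localCenter E c N J J₁ hJ₁ v))) χ₁))
    (hiso : AreIsomorphicRep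
      (TwistedCoinv.rep (ρW := show Representation ℂ (UnitaryGroup.localPi E c 1 J₁ v)
          (SchwartzBruhat (Fin N → v.adicCompletion F)) from
          ((MpPsi.toRep (localSchrodinger F N T v)).comp s₁).comp (UnitaryGroup.localCenter E c N J J₁ hJ₁ v)) χ₁
        ((MpPsi.toRep (localSchrodinger F N T v)).comp s₁)
        (fun g z => (show Commute g (UnitaryGroup.localCenter E c N J J₁ hJ₁ v z) from
          UnitaryGroup.localCenter_comm E c N J J₁ hJ₁ v z g).map ((MpPsi.toRep (localSchrodinger F N T v)).comp s₁)))
      (TwistedCoinv.rep (ρW := show Representation ℂ (UnitaryGroup.localPi E c 1 J₁ v)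
          (SchwartzBruhat (Fin N → v.adicCompletion F)) from
          ((MpPsi.toRep (localSchrodinger F N T v)).comp s₂).comp (UnitaryGroup.localCenter E c N J J₁ hJ₁ v)) χ₂
        ((MpPsi.toRep (localSchrodinger F N T v)).comp s₂)
        (fun g z => (show Commute g (UnitaryGroup.localCenter E c N J J₁ hJ₁ v z) from
          UnitaryGroup.localCenter_comm E c N J J₁ hJ₁ v z g).map ((MpPsi.toRep (localSchrodinger F N T v)).comp s₂))))
    {ι : Type} [Fintype ι] [DecidableEq ι] (e : Fin N ⊕ Fin N ≃ ι) :
    ∃ Λ : SchwartzBruhat (ι → v.adicCompletion F) →ₗ[ℂ] ℂ, Λ ≠ 0 ∧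
      ∀ g : UnitaryGroup.localPi E c N J v, ∃ r : ℂ, r ≠ 0 ∧
        Λ ∘ₗ sumEndSB (v.adicCompletion F) e
            ((((MpPsi.toRep (localSchrodinger F N T v)).comp s₁) g : SchwartzBruhat (Fin N → v.adicCompletion F) →ₗ[ℂ]
              SchwartzBruhat (Fin N → v.adicCompletion F)))
            (conjOp (MpPsi.toOp (localSchrodinger F N T v) (s₂ g))).toLinearMap = r • Λ := by
  /- §0 the non-split place: compact centre, smooth centre action, open kernel -/
  have hc1 : c ≠ 1 := by
    rintro rfl
    exact hδ (self_eq_neg.1 (by simpa only [AlgEquiv.one_apply] using hcδ))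
  obtain ⟨w⟩ := (inferInstance : Nonempty (PlacesOver E v))
  have hw : c • w.1 = w.1 := by
    by_contra hw
    exact LemD1IndexedNonVacuityAtPlace.not_isField_localRing_of_split E v c w hw hE
  haveI : CompactSpace (localPi E c 1 J₁ v) := compactSpace_localPi_one_of_smul_eq c J₁ hc1 hJ₁ w hw
  let ω₁ : Representation ℂ (localPi E c N J v) (SchwartzBruhat (Fin N → v.adicCompletion F)) :=
    (MpPsi.toRep (localSchrodinger F N T v)).comp s₁
  let ω₂ : Representation ℂ (localPi E c N J v) (SchwartzBruhat (Fin N → v.adicCompletion F)) :=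
    (MpPsi.toRep (localSchrodinger F N T v)).comp s₂
  let M₁ : Representation ℂ (localPi E c 1 J₁ v) (SchwartzBruhat (Fin N → v.adicCompletion F)) :=
    ω₁.comp (localCenter E c N J J₁ hJ₁ v)
  let M₂ : Representation ℂ (localPi E c 1 J₁ v) (SchwartzBruhat (Fin N → v.adicCompletion F)) :=
    ω₂.comp (localCenter E c N J J₁ hJ₁ v)
  have hM₂s : M₂.IsSmooth := fun Φ =>
    show IsOpen ((localCenter E c N J J₁ hJ₁ v) ⁻¹'
      ((Representation.stabilizerSubgroup ω₂ Φ : Subgroup (localPi E c N J v)) : Set (localPi E c N J v))) from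
      (hsm₂ Φ).preimage (continuous_localCenter E c N J J₁ hJ₁ v)
  have hχ₂o : IsOpen (χ₂.ker : Set (localPi E c 1 J₁ v)) := isOpen_ker_of_smul_eq c J₁ hc1 hJ₁ w hw χ₂ hχ₂c
  have hcomm₁ : ∀ (g : localPi E c N J v) (z : localPi E c 1 J₁ v), Commute (ω₁ g) (M₁ z) := fun g z =>
    (show Commute g (localCenter E c N J J₁ hJ₁ v z) from localCenter_comm E c N J J₁ hJ₁ v z g).map ω₁
  have hcomm₂ : ∀ (g : localPi E c N J v) (z : localPi E c 1 J₁ v), Commute (ω₂ g) (M₂ z) := fun g z =>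
    (show Commute g (localCenter E c N J J₁ hJ₁ v z) from localCenter_comm E c N J J₁ hJ₁ v z g).map ω₂
  /- §1 the intertwiner `T ≠ 0` (P1a) -/
  haveI := hnt
  obtain ⟨f, hf⟩ := hiso
  obtain ⟨Tm, hT0, hTg, -, -⟩ := TwistedCoinv.exists_intertwiner_ne_zero_of_coinv_equiv
    (ρW₁ := M₁) (ρW₂ := M₂) ω₁ hcomm₁ ω₂ hcomm₂ χ₁ χ₂ hM₂s hχ₂o f (fun g x => hf g x)
  /- §2 the doubled functional `Λ = ∫_Δ ∘ (T ⊠ 1)` (P1b) -/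
  letI : MeasurableSpace (v.adicCompletion F) := borel _
  haveI : BorelSpace (v.adicCompletion F) := ⟨rfl⟩
  haveI := secondCountableTopology_adicCompletion F v
  let μ : Measure (Fin N → v.adicCompletion F) :=
    Measure.pi fun _ : Fin N => (Measure.addHaar : Measure (v.adicCompletion F))
  refine ⟨diagIntegral e μ ∘ₗ sumEndSB (v.adicCompletion F) e Tm LinearMap.id,
    diagIntegral_sumEndSB_ne_zero e μ Tm hT0, fun g => ?_⟩
  /- §3 conformality of `ω_{s₂}(g)` and polarization -/
  obtain ⟨cg, hc0, hctop, hcg⟩ :=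
    exists_l2NormSq_toRep_comp_eq_mul (hTd := hTd) (Measure.addHaar : Measure (v.adicCompletion F)) s₂ g
  have hr : ((cg.toReal : ℝ) : ℂ) ≠ 0 := by
    exact_mod_cast (ENNReal.toReal_pos hc0 hctop).ne'
  refine ⟨((cg.toReal : ℝ) : ℂ), hr, ?_⟩
  have hωop : (ω₂ g : SchwartzBruhat (Fin N → v.adicCompletion F) →ₗ[ℂ] SchwartzBruhat (Fin N → v.adicCompletion F)) =
      (MpPsi.toOp (localSchrodinger F N T v) (s₂ g)).toLinearMap :=
    LinearMap.ext fun Φ => rfl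
  refine diagIntegral_sumEndSB_quasiInvariant e μ Tm (ω₁ g) (MpPsi.toOp (localSchrodinger F N T v) (s₂ g))
    (by rw [← hωop]; exact hTg g) _ fun φ ψ => ?_
  -- `∫ (ω₂ g φ) conj(ω₂ g ψ) = c_g ∫ φ conj ψ`
  have hpol := SchwartzBruhat.integral_conj_mul_map_map_of_l2NormSq_eq_mul μ
    (ω₂ g : SchwartzBruhat (Fin N → v.adicCompletion F) →ₗ[ℂ] SchwartzBruhat (Fin N → v.adicCompletion F)) hcg ψ φ
  simp_rw [mul_comm (conj _) _] at hpol
  rw [hωop] at hpol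
  exact hpol

end Literature.RepresentationTheory.MoeglinVignerasWaldspurger1987

end
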